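import Summits.ValiantsHypothesis.ValiantsHypothesis.Theorems.LacunarySymmetroidMatrixDescartesVLawCoreBoundary

/-!
# `MatrixDescartes` (stmt-ValiantsHypothesis-18050), line `Lift` — the NEGATIVE kernel window `γ ∈ (0, 1)`:
# Stieltjes integrals for NEGATIVE semidefinite letters between the factoring letter and the pivot

HONEST FRAMING.  Cell `pub-symmetroid`, seat `val-sym-mdr-p2` (gen 3); helper `--supports` the crux
`Theses.LacunarySymmetroid.MatrixDescartes`, NO closure claim.  Analysis layer for the SIGNED fan law (companion files
`…VLawCoreSignedEntries.lean`, `…VLawCoreSigned.lean`, `…FanLawFour.lean`); nothing here bears on `stub_twoSided` in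
general, the crux in its window, `DoorA26`/`DoorA34`, or `VP ≠ VNP`.

THE OBSERVATION.  In the Gram decomposition of `…VLawCore` (factoring letter `P` at gap `a`, weight `w = (u^a)⁻¹`), a
letter on the SAME side as `P` but CLOSER to the pivot (gap `c` with `0 < c < a`) has weight `(u^c)⁻¹ = w^{c/a}`,
`γ = c/a ∈ (0,1)` — a Bernstein function: `w^γ = C⁻¹ ∫ w/(w+ρ^a) ρ^{c-1} dρ` (rpow-free), whose second divided
differences `[p,q,t](w/(w+σ)) = −σ/((p+σ)(q+σ)(t+σ))` are NEGATIVE mixtures of rank-one kernels.  Hence such a letter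
contributes a NONNEGATIVE Gram block exactly when it is NEGATIVE semidefinite.  This file supplies the three kernel
integrals (`offdiag_integral₃`, `diag_integral₃`), the pointwise quadratic form (`quadForm_y₃`), integrability,
continuity and the sum/integral interchange for the kernel `ρ^n r_t(ρ) · ρ^a r_p(ρ) r_q(ρ)` (`r_w = (w+ρ^a)⁻¹`), and
the power bookkeeping `signed_pow`.  [folklore] Bernstein/Stieltjes functions; elementary given `…VLawStieltjes`.
-/

-- layout Summits/ValiantsHypothesis/ValiantsHypothesis forces the duplicated namespace component
set_option linter.dupNamespace false

namespace Summit.ValiantsHypothesis.ValiantsHypothesis.Theorems.LacunarySymmetroidMatrixDescartes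

open MeasureTheory Set Filter Topology Matrix Finset
open scoped BigOperators
open VLawNormalForm

namespace VLawKernelThree

/-! ## Kernel integrals for the weight `w ↦ w · ∫ ρ^n/(w+ρ^a)` -/

section Integrals

/-- **Off-diagonal kernel integral, negative window.**  With `I_w = ∫ ρ^n/(w+ρ^a) = g_w · C`:
`(q−p)(t−p)(t−q) · ∫ ρ^n r_t (ρ^a r_p) r_q = −C · ((t−q) p g_p − (t−p) q g_q + (q−p) t g_t)`
(partial fractions of `w (w+σ)⁻¹ = 1 − σ (w+σ)⁻¹`). [folklore] -/
theorem offdiag_integral₃ {n a : ℕ} (hna : n + 2 ≤ a) {p q t : ℝ} (hp : 0 < p) (hq : 0 < q) (ht : 0 < t)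
    {gp gq gt C : ℝ} (ep : ∫ ρ in Ioi (0:ℝ), ρ ^ n / (p + ρ ^ a) = gp * C)
    (eq : ∫ ρ in Ioi (0:ℝ), ρ ^ n / (q + ρ ^ a) = gq * C) (et : ∫ ρ in Ioi (0:ℝ), ρ ^ n / (t + ρ ^ a) = gt * C) :
    (q - p) * (t - p) * (t - q) * ∫ ρ in Ioi (0:ℝ), ρ ^ n / (t + ρ ^ a)
        * ((ρ ^ a * (p + ρ ^ a)⁻¹) * (q + ρ ^ a)⁻¹)
      = -(C * ((t - q) * (p * gp) - (t - p) * (q * gq) + (q - p) * (t * gt))) := by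
  have hIp := VLawStieltjes.integrableOn_stieltjes hna hp
  have hIq := VLawStieltjes.integrableOn_stieltjes hna hq
  have hIt := VLawStieltjes.integrableOn_stieltjes hna ht
  have hcongr : EqOn (fun ρ : ℝ => (q - p) * (t - p) * (t - q) * (ρ ^ n / (t + ρ ^ a)
        * ((ρ ^ a * (p + ρ ^ a)⁻¹) * (q + ρ ^ a)⁻¹)))
      (fun ρ => -((t - q) * p * (ρ ^ n / (p + ρ ^ a)) - (t - p) * q * (ρ ^ n / (q + ρ ^ a))
        + (q - p) * t * (ρ ^ n / (t + ρ ^ a)))) (Ioi 0) := by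
    intro ρ hρ
    have h1 : p + ρ ^ a ≠ 0 := (VLawStieltjes.den_pos hp a hρ.out.le).ne'
    have h2 : q + ρ ^ a ≠ 0 := (VLawStieltjes.den_pos hq a hρ.out.le).ne'
    have h3 : t + ρ ^ a ≠ 0 := (VLawStieltjes.den_pos ht a hρ.out.le).ne'
    simp only
    field_simp
    ring
  rw [← integral_const_mul, setIntegral_congr_fun measurableSet_Ioi hcongr, integral_neg,
    integral_add ((hIp.const_mul _).sub' (hIq.const_mul _)) (hIt.const_mul _),
    integral_sub (hIp.const_mul _) (hIq.const_mul _), integral_const_mul, integral_const_mul, integral_const_mul,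
    ep, eq, et]
  ring

/-- **Diagonal kernel integral, negative window.**  With `I_p = g_p C`, `I_t = g_t C`, `∫ ρ^n/(p+ρ^a)^2 = h_p C`:
`(t−p)^2 · ∫ ρ^n r_t (ρ^a r_p) r_p = −C · (t g_t − p g_p − (t−p)(g_p − p h_p))`
(Taylor remainder of `w (w+σ)⁻¹`, whose derivative is `(w+σ)⁻¹ − w (w+σ)⁻²`). [folklore] -/
theorem diag_integral₃ {n a : ℕ} (hna : n + 2 ≤ a) {p t : ℝ} (hp : 0 < p) (ht : 0 < t) {gp gt hp2 C : ℝ}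
    (ep : ∫ ρ in Ioi (0:ℝ), ρ ^ n / (p + ρ ^ a) = gp * C) (et : ∫ ρ in Ioi (0:ℝ), ρ ^ n / (t + ρ ^ a) = gt * C)
    (ep2 : ∫ ρ in Ioi (0:ℝ), ρ ^ n / (p + ρ ^ a) ^ 2 = hp2 * C) :
    (t - p) ^ 2 * ∫ ρ in Ioi (0:ℝ), ρ ^ n / (t + ρ ^ a) * ((ρ ^ a * (p + ρ ^ a)⁻¹) * (p + ρ ^ a)⁻¹)
      = -(C * (t * gt - p * gp - (t - p) * (gp - p * hp2))) := by
  have hIp := VLawStieltjes.integrableOn_stieltjes hna hp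
  have hIt := VLawStieltjes.integrableOn_stieltjes hna ht
  have hIp2 := VLawStieltjes.integrableOn_stieltjes_sq hna hp
  have hcongr : EqOn (fun ρ : ℝ => (t - p) ^ 2 * (ρ ^ n / (t + ρ ^ a)
        * ((ρ ^ a * (p + ρ ^ a)⁻¹) * (p + ρ ^ a)⁻¹)))
      (fun ρ => -(t * (ρ ^ n / (t + ρ ^ a)) - (p + (t - p)) * (ρ ^ n / (p + ρ ^ a))
        + (t - p) * p * (ρ ^ n / (p + ρ ^ a) ^ 2))) (Ioi 0) := by
    intro ρ hρ
    have h1 : p + ρ ^ a ≠ 0 := (VLawStieltjes.den_pos hp a hρ.out.le).ne'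
    have h3 : t + ρ ^ a ≠ 0 := (VLawStieltjes.den_pos ht a hρ.out.le).ne'
    simp only
    field_simp
    ring
  rw [← integral_const_mul, setIntegral_congr_fun measurableSet_Ioi hcongr, integral_neg,
    integral_add ((hIt.const_mul _).sub' (hIp.const_mul _)) (hIp2.const_mul _),
    integral_sub (hIt.const_mul _) (hIp.const_mul _), integral_const_mul, integral_const_mul, integral_const_mul,
    ep, et, ep2]
  ring

/-- Pointwise: the negative-window kernel integrand is `ρ^n r_t(ρ) · ρ^a` times the quadratic form of `N` at
`y_ρ = ∑ i, (e i · r_{w i}(ρ)) • v i`. [folklore] -/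
theorem quadForm_y₃ {ι : Type*} [Fintype ι] {k : ℕ} (n a : ℕ) (w : Fin k → ℝ) (t : ℝ) (Nm : Matrix ι ι ℝ)
    (v : Fin k → ι → ℝ) (e : Fin k → ℝ) (ρ : ℝ) :
    ∑ i, ∑ j, e i * e j * (v i ⬝ᵥ (Nm *ᵥ v j))
        * (ρ ^ n / (t + ρ ^ a) * ((ρ ^ a * (w i + ρ ^ a)⁻¹) * (w j + ρ ^ a)⁻¹))
      = ρ ^ n / (t + ρ ^ a) * ρ ^ a *
        ((∑ i, (e i * (w i + ρ ^ a)⁻¹) • v i) ⬝ᵥ (Nm *ᵥ ∑ j, (e j * (w j + ρ ^ a)⁻¹) • v j)) := by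
  rw [quadForm_sum_smul Nm (fun i => e i * (w i + ρ ^ a)⁻¹) v, Finset.mul_sum]
  refine Finset.sum_congr rfl fun i _ => ?_
  rw [Finset.mul_sum]
  refine Finset.sum_congr rfl fun j _ => ?_
  ring

/-- Every summand of the negative-window kernel integrand is integrable on `(0, ∞)`. [folklore] -/
theorem integrableOn_kernel_term₃ {n a : ℕ} (hna : n + 2 ≤ a) {wi wj t : ℝ} (hwi : 0 < wi) (hwj : 0 < wj)
    (ht : 0 < t) (κ0 : ℝ) :
    IntegrableOn (fun ρ : ℝ => κ0 * (ρ ^ n / (t + ρ ^ a)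
      * ((ρ ^ a * (wi + ρ ^ a)⁻¹) * (wj + ρ ^ a)⁻¹))) (Ioi 0) := by
  refine Integrable.const_mul ?_ κ0
  have hcont : ContinuousOn (fun ρ : ℝ => ρ ^ a * (wi + ρ ^ a)⁻¹) (Ioi 0) :=
    (continuousOn_pow a).mul ((VLawStieltjes.continuousOn_inv_den a hwi).mono Ioi_subset_Ici_self)
  have hbd : ∀ ρ : ℝ, 0 < ρ → 0 ≤ ρ ^ a * (wi + ρ ^ a)⁻¹ ∧ ρ ^ a * (wi + ρ ^ a)⁻¹ ≤ 1 := by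
    intro ρ hρ
    have hden := VLawStieltjes.den_pos hwi a hρ.le
    refine ⟨mul_nonneg (pow_nonneg hρ.le a) (inv_nonneg.2 hden.le), ?_⟩
    rw [← div_eq_mul_inv, div_le_one hden]
    linarith
  refine VLawStieltjes.integrableOn_stieltjes_mul hna ht
    (hcont.mul ((VLawStieltjes.continuousOn_inv_den a hwj).mono Ioi_subset_Ici_self)) (B := wj⁻¹) fun ρ hρ => ?_
  have h1 := hbd ρ hρ
  have h2 := VLawStieltjes.inv_den_le (a := a) hwj hρ.le
  rw [abs_of_nonneg (mul_nonneg h1.1 h2.1)]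
  calc ρ ^ a * (wi + ρ ^ a)⁻¹ * (wj + ρ ^ a)⁻¹ ≤ 1 * wj⁻¹ := mul_le_mul h1.2 h2.2 h2.1 zero_le_one
    _ = wj⁻¹ := one_mul _

/-- **Interchange** of the finite double sum and the integral (negative-window kernel). [folklore] -/
theorem integral_quadForm₃ {ι : Type*} [Fintype ι] {k n a : ℕ} (hna : n + 2 ≤ a) (w : Fin k → ℝ)
    (hw : ∀ i, 0 < w i) {t : ℝ} (ht : 0 < t) (Nm : Matrix ι ι ℝ) (v : Fin k → ι → ℝ) (e : Fin k → ℝ) :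
    ∫ ρ in Ioi (0:ℝ), ∑ i, ∑ j, e i * e j * (v i ⬝ᵥ (Nm *ᵥ v j))
        * (ρ ^ n / (t + ρ ^ a) * ((ρ ^ a * (w i + ρ ^ a)⁻¹) * (w j + ρ ^ a)⁻¹))
      = ∑ i, ∑ j, e i * e j * (v i ⬝ᵥ (Nm *ᵥ v j))
        * ∫ ρ in Ioi (0:ℝ), ρ ^ n / (t + ρ ^ a) * ((ρ ^ a * (w i + ρ ^ a)⁻¹) * (w j + ρ ^ a)⁻¹) := by
  rw [integral_finsetSum _ fun i _ => integrable_finsetSum _ fun j _ =>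
    integrableOn_kernel_term₃ hna (hw i) (hw j) ht _]
  refine Finset.sum_congr rfl fun i _ => ?_
  rw [integral_finsetSum _ fun j _ => integrableOn_kernel_term₃ hna (hw i) (hw j) ht _]
  refine Finset.sum_congr rfl fun j _ => ?_
  exact integral_const_mul _ _

/-- The negative-window kernel integrand is continuous on `(0, ∞)`. [folklore] -/
theorem continuousOn_kernelSum₃ {k : ℕ} (n a : ℕ) {w : Fin k → ℝ} (hw : ∀ i, 0 < w i) {t : ℝ} (ht : 0 < t)
    (Nh : Fin k → Fin k → ℝ) (e : Fin k → ℝ) :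
    ContinuousOn (fun ρ : ℝ => ∑ i, ∑ j, e i * e j * Nh i j
        * (ρ ^ n / (t + ρ ^ a) * ((ρ ^ a * (w i + ρ ^ a)⁻¹) * (w j + ρ ^ a)⁻¹))) (Ioi 0) := by
  refine continuousOn_finsetSum _ fun i _ => continuousOn_finsetSum _ fun j _ => ?_
  refine ContinuousOn.mul continuousOn_const ?_
  refine ((VLawStieltjes.continuousOn_stieltjes n a ht).mono Ioi_subset_Ici_self).mul ?_
  exact ((continuousOn_pow a).mul ((VLawStieltjes.continuousOn_inv_den a (hw i)).mono Ioi_subset_Ici_self)).mul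
    ((VLawStieltjes.continuousOn_inv_den a (hw j)).mono Ioi_subset_Ici_self)

end Integrals

/-! ## Power bookkeeping for a negative-window letter -/

/-- With `c + b = a` (gap `c` of the letter, `b = a − c`) and `u > 0`:
`(u^a)⁻¹ · u^b = (u^c)⁻¹` and `u^b − (u^a)⁻¹ · ((b/a) u^{a+b}) = (c/a) · u^a · (u^c)⁻¹`. [folklore] -/
theorem signed_pow {a c b : ℕ} (ha : 0 < a) (hc : c + b = a) {u : ℝ} (hu : 0 < u) :
    (u ^ a)⁻¹ * u ^ b = (u ^ c)⁻¹
    ∧ u ^ b - (u ^ a)⁻¹ * (((b : ℝ) / a) * u ^ (a + b)) = ((c : ℝ) / a) * u ^ a * (u ^ c)⁻¹ := by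
  have hu0 : u ≠ 0 := hu.ne'
  have hua : u ^ a ≠ 0 := pow_ne_zero a hu0
  have huc : u ^ c ≠ 0 := pow_ne_zero c hu0
  have ha0 : (a : ℝ) ≠ 0 := by exact_mod_cast ha.ne'
  have hX : u ^ a = u ^ c * u ^ b := by rw [← pow_add, hc]
  have hcast : (c : ℝ) = a - b := by
    have : (c : ℝ) + b = a := by exact_mod_cast hc
    linarith
  have h1 : (u ^ a)⁻¹ * u ^ b = (u ^ c)⁻¹ := by
    rw [hX, mul_inv, mul_assoc, inv_mul_cancel₀ (pow_ne_zero b hu0), mul_one]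
  refine ⟨h1, ?_⟩
  calc u ^ b - (u ^ a)⁻¹ * (((b : ℝ) / a) * u ^ (a + b))
      = (1 - (b : ℝ) / a) * u ^ b := by rw [pow_add]; field_simp
    _ = ((c : ℝ) / a) * u ^ a * ((u ^ a)⁻¹ * u ^ b) := by
        rw [hcast]; field_simp
    _ = ((c : ℝ) / a) * u ^ a * (u ^ c)⁻¹ := by rw [h1]

end VLawKernelThree

end Summit.ValiantsHypothesis.ValiantsHypothesis.Theorems.LacunarySymmetroidMatrixDescartes
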